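import Summits.QuantumFields.GaugeBoot.TiltedBoxLimitInPlaneGeometry
import Summits.QuantumFields.GaugeBoot.TiltedBoxLimitAxisRP
import Summits.QuantumFields.GaugeBoot.TiltedBoxOddAxisRPTwoDim
import Summits.QuantumFields.GaugeBoot.TiltedBoxEvenMidAxisRPTwoDim
import Summits.QuantumFields.GaugeBoot.ZdWordLinkReflection
import Summits.QuantumFields.GaugeBoot.ClassBIdentification
import HarnessLib

/-!
# Infinite-volume limit points of the 45°-tilted boxes, part 16: in-plane axis reflection positivity in two dimensions

HONEST FRAMING (cell `pub-gaugeboot`, page 1 of every file): the venture produces certified bounds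
on lattice expectations at stated coupling, gauge group, dimension and torus size; NOT a mass gap,
NOT a continuum limit, NOT a string tension; NOT Yang–Mills-summit-bearing (barriers
`FixedCouplingUltralocality`, `PerturbativeInvisibility`). Structural POSITIVE facts about a class
of infinite-volume Wilson states in TWO dimensions; nothing else is claimed.

## Content

Along the in-plane axes `i`, `j` parts 1–15 claim no reflection positivity for tilted limit points:
on every box of the family the in-plane mirrors are symmetries but, in `d ≥ 3`, not of positive type
(`TiltedBoxInPlaneMirrorClassification.lean`). In `d = 2` (`∀ k, k = i ∨ k = j`) two of the four
mirror classes ARE of positive type on the boxes, at every real `β`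
(`TwoDim.tiltedBox_axisRP_odd_twoDim`: the site mirror `x_i ↦ -x_i` of the ODD boxes, closed half
`{0 ≤ x_i ≤ P}`; `TwoDim.tiltedBox_midAxisRP_twoDim`: the link mirror `x_i ↦ 1 - x_i` of the EVEN
boxes, closed half `{1 ≤ x_i ≤ P}`), and this positivity passes to the limit:

* `siteRP_axis_of_isTiltedBoxLimitAlong`, `siteRP_axis'_…` — a limit point along a family of square
  boxes `Γ(M_k + 2, M_k + 2, ·)` with `M_k + 2` odd for infinitely many `k` is reflection positive in
  the site hyperplanes `x_i = 0` AND `x_j = 0` (`siteHalfEdges`); 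
* `linkRP_axis_of_isTiltedBoxLimitAlong`, `linkRP_axis'_…` — one along a family with `M_k + 2` even
  for infinitely many `k` is reflection positive in the link hyperplanes `x_i = ½` and `x_j = ½`;
* **`siteRP_or_linkRP_axes_of_mem_tiltedBoxLimitPoints`** — hence EVERY two-dimensional tilted limit
  point (`tiltedBoxLimitPoints d i j ρ β`, `i ≠ j` exhausting the axes, compact Hausdorff second
  countable `G`, continuous `ρ`, every real `β`) is site-reflection positive along both axes or
  link-reflection positive along both axes;
* `exists_isTiltedBoxLimitAlong_odd`, `exists_isTiltedBoxLimitAlong_even` — both kinds of limit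
  points exist at every real `β` (compactness along the odd, resp. even, sub-family).

The axis `j` is reached from the axis `i` by conjugation with the swap `(i j)`, a symmetry of every
tilted limit point (`IsReflectionPositiveFor.of_conj`, `TiltedBoxLimitInPlaneGeometry.lean`).
Together with parts 4–7 (diagonal and anti-diagonal RP, the Haar-shift identity, the symmetries) a
two-dimensional tilted limit point along odd boxes thus carries every Class-B constraint except link
RP, one along even boxes every one except site RP. NOT claimed: both families for one limit point
(that is the uniqueness question), anything in `d ≥ 3`.

References: K. Osterwalder, E. Seiler, Ann. Phys. 110 (1978) 440, §2; E. Seiler, LNP 159 (1982)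
Thm. 2.2; A. A. Migdal, Sov. Phys. JETP 42 (1975) 413 (the 2D recursion behind the box theorems);
S. Friedli, Y. Velenik (2017) Ch. 10 (RP of torus states and their limits).
-/

noncomputable section

open MeasureTheory Filter Topology
open scoped ComplexOrder ComplexConjugate
open Literature.Probability.LatticeModels (Site)
open Literature.MathematicalPhysics.QuantumLattice

namespace Summit.QuantumFields.GaugeBoot

namespace TiltedRP

variable {d : ℕ} {i j : Fin d} {N : ℕ}
variable {G : Type*} [Group G] [TopologicalSpace G] [IsTopologicalGroup G] [CompactSpace G]
  [MeasurableSpace G] [BorelSpace G] [SecondCountableTopology G]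
variable (ρ : G →* Matrix (Fin N) (Fin N) ℂ)

/-! ## Box steps: the two-dimensional positivity read through the lift -/

section Box

variable {M L : ℕ} [NeZero M] [NeZero L]

/-- **Box step, odd side, site mirror** (`d = 2`): on the square box of odd side `M = 2P + 1`,
`P ≥ m + 1`, the site RP pairing along `i` of the lift of a bounded measurable cylinder observable
of `{x_i ≥ 0}` with `x_i ≤ m` on its support is non-negative (`TwoDim.tiltedBox_axisRP_odd_twoDim`). -/
theorem box_axisSiteRP_nonneg {P : ℕ} [NeZero P] (hM : M = 2 * P + 1) (hij : i ≠ j)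
    (hd : ∀ k : Fin d, k = i ∨ k = j) (hρ : Continuous ρ) (β : ℝ) {F : LGConfig d G → ℂ}
    {T : Finset (ZdEdge d)} (hFT : IsCylinder F T) (hFm : Measurable F) {C : ℝ}
    (hC : ∀ U, ‖F U‖ ≤ C) (hT : ∀ e ∈ T, e ∈ siteHalfEdges i) {m : ℕ} (hTm : ∀ e ∈ T, e.1 i ≤ m)
    (hm : m + 1 ≤ P) :
    0 ≤ ∫ U, conj (F (configSiteReflect i (tiltedLift d i j M M L U))) *
      F (tiltedLift d i j M M L U) ∂(gibbs ρ (tiltedUnit d i j M M L) β) := by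
  subst hM
  have hpos := TwoDim.tiltedBox_axisRP_odd_twoDim ρ hij hd hρ β
    (fun U => F (tiltedLift d i j (2 * P + 1) (2 * P + 1) L U))
    (hFm.comp (measurable_tiltedLift d i j _ _ L)) ⟨C, fun U => hC _⟩
    (isHalfObservable_axis_comp_tiltedLift hFT hT hTm hm)
  simpa only [tiltedLift_configReflect_axis] using hpos

/-- **Box step, even side, link mirror** (`d = 2`): on the square box of even side `M = 2P`,
`P ≥ 2`, `P ≥ m + 1`, the link RP pairing along `i` of the lift of a bounded measurable cylinder
observable of `{x_i ≥ 1}` with `x_i ≤ m` on its support is non-negative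
(`TwoDim.tiltedBox_midAxisRP_twoDim`). -/
theorem box_axisLinkRP_nonneg {P : ℕ} [NeZero P] (hM : M = 2 * P) (hP : 2 ≤ P) (hij : i ≠ j)
    (hd : ∀ k : Fin d, k = i ∨ k = j) (hρ : Continuous ρ) (β : ℝ) {F : LGConfig d G → ℂ}
    {T : Finset (ZdEdge d)} (hFT : IsCylinder F T) (hFm : Measurable F) {C : ℝ}
    (hC : ∀ U, ‖F U‖ ≤ C) (hT : ∀ e ∈ T, e ∈ linkHalfEdges i) {m : ℕ} (hTm : ∀ e ∈ T, e.1 i ≤ m)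
    (hm : m + 1 ≤ P) :
    0 ≤ ∫ U, conj (F (configLinkReflect i (tiltedLift d i j M M L U))) *
      F (tiltedLift d i j M M L U) ∂(gibbs ρ (tiltedUnit d i j M M L) β) := by
  subst hM
  have hpos := TwoDim.tiltedBox_midAxisRP_twoDim ρ hP hij hd hρ β
    (fun U => F (tiltedLift d i j (2 * P) (2 * P) L U))
    (hFm.comp (measurable_tiltedLift d i j _ _ L)) ⟨C, fun U => hC _⟩
    (isMidObservable_axis_comp_tiltedLift hFT hT hTm hm)
  simpa only [tiltedLift_configMidReflect_axis] using hpos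

end Box

/-! ## Subsequences of a limit family -/

omit [SecondCountableTopology G] in
/-- A limit along a family is a limit along every subfamily. -/
theorem IsTiltedBoxLimitAlong.comp_strictMono {β : ℝ} {M Q : ℕ → ℕ} {μ : Measure (LGConfig d G)}
    (h : IsTiltedBoxLimitAlong d i j ρ β M Q μ) {φ : ℕ → ℕ} (hφ : StrictMono φ) :
    IsTiltedBoxLimitAlong d i j ρ β (M ∘ φ) (Q ∘ φ) μ :=
  ⟨h.1, fun F S hFS hFc hFb => (h.2 F S hFS hFc hFb).comp hφ.tendsto_atTop⟩

/-! ## The pairings of the limit points on continuous cylinder observables -/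

/-- **Site pairing along `i`, odd family**: if `μ` is the limit along square boxes of ODD sides
`M_k + 2 → ∞` (`d = 2`), then `∫ conj F(configSiteReflect i U) F(U) dμ ≥ 0` for every bounded
continuous cylinder observable `F` of `{x_i ≥ 0}`. -/
theorem integral_axisSiteReflect_nonneg_of_cylinder (hij : i ≠ j) (hd : ∀ k : Fin d, k = i ∨ k = j)
    (hρ : Continuous ρ) {β : ℝ} {M Q : ℕ → ℕ} {μ : Measure (LGConfig d G)}
    (h : IsTiltedBoxLimitAlong d i j ρ β M Q μ) (hM : Tendsto M atTop atTop)
    (hodd : ∀ k, Odd (M k + 2)) {F : LGConfig d G → ℂ} {T : Finset (ZdEdge d)}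
    (hFT : IsCylinder F T) (hFc : Continuous F) {C : ℝ} (hC : ∀ U, ‖F U‖ ≤ C)
    (hFS : DependsOn F (siteHalfEdges i)) :
    0 ≤ ∫ U, conj (F (configSiteReflect i U)) * F U ∂μ := by
  classical
  set T' : Finset (ZdEdge d) := T.filter (· ∈ siteHalfEdges (d := d) i) with hT'
  have hFT' : IsCylinder F T' := isCylinder_filter_of_dependsOn hFT hFS
  have hTh : ∀ e ∈ T', e ∈ siteHalfEdges i := fun e he => (Finset.mem_filter.1 he).2
  obtain ⟨m, hm⟩ : ∃ m : ℕ, ∀ e ∈ T', e.1 i ≤ m := by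
    refine ⟨T'.sup fun e => (e.1 i).toNat, fun e he => ?_⟩
    have hle := Finset.le_sup (f := fun e : ZdEdge d => (e.1 i).toNat) he
    have : (e.1 i).toNat ≤ T'.sup fun e : ZdEdge d => (e.1 i).toNat := hle
    omega
  set H : LGConfig d G → ℂ := fun U => conj (F (configSiteReflect i U)) * F U with hH
  have hHc : Continuous H :=
    (Complex.continuous_conj.comp (hFc.comp (continuous_configSiteReflect i))).mul hFc
  obtain ⟨T₁, hT₁⟩ : ∃ T₁ : Finset (ZdEdge d), IsCylinder (F ∘ configSiteReflect i) T₁ :=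
    ⟨_, isCylinder_comp_configSiteReflect hFT i⟩
  have hHcyl : IsCylinder H (T₁ ∪ T) := by
    intro U V hUV
    have e1 := hT₁ fun e he => hUV e (by rw [Finset.coe_union]; exact Or.inl he)
    have e2 := hFT fun e he => hUV e (by rw [Finset.coe_union]; exact Or.inr he)
    simp only [Function.comp_apply] at e1
    simp only [hH, e1, e2]
  have hHb : ∀ U, ‖H U‖ ≤ C * C := fun U => by
    simp only [hH, norm_mul, Complex.norm_conj]
    exact mul_le_mul (hC _) (hC _) (norm_nonneg _) ((norm_nonneg (F U)).trans (hC U))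
  refine h.integral_nonneg_of_eventually hρ hHcyl hHc hHb ?_
  have hev : ∀ᶠ k in atTop, 2 * m + 1 ≤ M k := hM.eventually_ge_atTop (2 * m + 1)
  refine hev.mono fun k hk => ?_
  obtain ⟨P, hP⟩ := hodd k
  haveI : NeZero P := ⟨by omega⟩
  exact box_axisSiteRP_nonneg ρ hP hij hd hρ β hFT' hFc.measurable hC hTh hm (by omega)

/-- **Link pairing along `i`, even family**: if `μ` is the limit along square boxes of EVEN sides
`M_k + 2 → ∞` (`d = 2`), then `∫ conj F(configLinkReflect i U) F(U) dμ ≥ 0` for every bounded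
continuous cylinder observable `F` of `{x_i ≥ 1}`. -/
theorem integral_axisLinkReflect_nonneg_of_cylinder (hij : i ≠ j) (hd : ∀ k : Fin d, k = i ∨ k = j)
    (hρ : Continuous ρ) {β : ℝ} {M Q : ℕ → ℕ} {μ : Measure (LGConfig d G)}
    (h : IsTiltedBoxLimitAlong d i j ρ β M Q μ) (hM : Tendsto M atTop atTop)
    (heven : ∀ k, Even (M k + 2)) {F : LGConfig d G → ℂ} {T : Finset (ZdEdge d)}
    (hFT : IsCylinder F T) (hFc : Continuous F) {C : ℝ} (hC : ∀ U, ‖F U‖ ≤ C)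
    (hFS : DependsOn F (linkHalfEdges i)) :
    0 ≤ ∫ U, conj (F (configLinkReflect i U)) * F U ∂μ := by
  classical
  set T' : Finset (ZdEdge d) := T.filter (· ∈ linkHalfEdges (d := d) i) with hT'
  have hFT' : IsCylinder F T' := isCylinder_filter_of_dependsOn hFT hFS
  have hTh : ∀ e ∈ T', e ∈ linkHalfEdges i := fun e he => (Finset.mem_filter.1 he).2
  obtain ⟨m, hm⟩ : ∃ m : ℕ, ∀ e ∈ T', e.1 i ≤ m := by
    refine ⟨T'.sup fun e => (e.1 i).toNat, fun e he => ?_⟩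
    have hle := Finset.le_sup (f := fun e : ZdEdge d => (e.1 i).toNat) he
    have : (e.1 i).toNat ≤ T'.sup fun e : ZdEdge d => (e.1 i).toNat := hle
    omega
  set H : LGConfig d G → ℂ := fun U => conj (F (configLinkReflect i U)) * F U with hH
  have hHc : Continuous H :=
    (Complex.continuous_conj.comp (hFc.comp (continuous_configLinkReflect i))).mul hFc
  obtain ⟨T₁, hT₁⟩ : ∃ T₁ : Finset (ZdEdge d), IsCylinder (F ∘ configLinkReflect i) T₁ :=
    ⟨_, isCylinder_comp_configLinkReflect hFT i⟩
  have hHcyl : IsCylinder H (T₁ ∪ T) := by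
    intro U V hUV
    have e1 := hT₁ fun e he => hUV e (by rw [Finset.coe_union]; exact Or.inl he)
    have e2 := hFT fun e he => hUV e (by rw [Finset.coe_union]; exact Or.inr he)
    simp only [Function.comp_apply] at e1
    simp only [hH, e1, e2]
  have hHb : ∀ U, ‖H U‖ ≤ C * C := fun U => by
    simp only [hH, norm_mul, Complex.norm_conj]
    exact mul_le_mul (hC _) (hC _) (norm_nonneg _) ((norm_nonneg (F U)).trans (hC U))
  refine h.integral_nonneg_of_eventually hρ hHcyl hHc hHb ?_
  have hev : ∀ᶠ k in atTop, 2 * m + 2 ≤ M k := hM.eventually_ge_atTop (2 * m + 2)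
  refine hev.mono fun k hk => ?_
  obtain ⟨P, hP⟩ := heven k
  haveI : NeZero P := ⟨by omega⟩
  exact box_axisLinkRP_nonneg ρ (P := P) (by omega) (by omega) hij hd hρ β hFT' hFc.measurable hC
    hTh hm (by omega)

/-! ## Reflection positivity along the in-plane axes -/

variable [T2Space G]

/-- **Site RP along `i` of a limit point along (frequently) odd boxes** (`d = 2`, every real `β`):
all bounded measurable observables of the closed half `{x_i ≥ 0}`. -/
theorem siteRP_axis_of_isTiltedBoxLimitAlong (hij : i ≠ j) (hd : ∀ k : Fin d, k = i ∨ k = j)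
    (hρ : Continuous ρ) {β : ℝ} {M Q : ℕ → ℕ} {μ : Measure (LGConfig d G)}
    (h : IsTiltedBoxLimitAlong d i j ρ β M Q μ) (hM : Tendsto M atTop atTop)
    (hQ : Tendsto Q atTop atTop) (hodd : ∃ᶠ k in atTop, Odd (M k + 2)) :
    IsReflectionPositiveFor (configSiteReflect (G := G) i) (siteHalfEdges i) μ := by
  obtain ⟨φ, hφ, hφodd⟩ := extraction_of_frequently_atTop hodd
  have hμ : μ ∈ tiltedBoxLimitPoints d i j ρ β := ⟨M, Q, hM, hQ, h⟩
  haveI := isProbabilityMeasure_of_mem_tiltedBoxLimitPoints hμ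
  exact IsReflectionPositiveFor.of_continuous_cylinder
    (reflectInvariant_of_mem_tiltedBoxLimitPoints ρ hij hρ hμ i)
    fun F T hFT hFc ⟨C, hC⟩ hFS =>
      integral_axisSiteReflect_nonneg_of_cylinder ρ hij hd hρ (h.comp_strictMono ρ hφ)
        (hM.comp hφ.tendsto_atTop) hφodd hFT hFc hC hFS

/-- **Link RP along `i` of a limit point along (frequently) even boxes** (`d = 2`, every real `β`):
all bounded measurable observables of the closed half `{x_i ≥ 1}`. -/
theorem linkRP_axis_of_isTiltedBoxLimitAlong (hij : i ≠ j) (hd : ∀ k : Fin d, k = i ∨ k = j)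
    (hρ : Continuous ρ) {β : ℝ} {M Q : ℕ → ℕ} {μ : Measure (LGConfig d G)}
    (h : IsTiltedBoxLimitAlong d i j ρ β M Q μ) (hM : Tendsto M atTop atTop)
    (hQ : Tendsto Q atTop atTop) (heven : ∃ᶠ k in atTop, Even (M k + 2)) :
    IsReflectionPositiveFor (configLinkReflect (G := G) i) (linkHalfEdges i) μ := by
  obtain ⟨φ, hφ, hφeven⟩ := extraction_of_frequently_atTop heven
  have hμ : μ ∈ tiltedBoxLimitPoints d i j ρ β := ⟨M, Q, hM, hQ, h⟩
  haveI := isProbabilityMeasure_of_mem_tiltedBoxLimitPoints hμ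
  exact IsReflectionPositiveFor.of_continuous_cylinder
    (measurePreserving_configLinkReflect
      (isZdTranslationInvariant_of_mem_tiltedBoxLimitPoints ρ hρ hμ)
      (reflectInvariant_of_mem_tiltedBoxLimitPoints ρ hij hρ hμ i))
    fun F T hFT hFc ⟨C, hC⟩ hFS =>
      integral_axisLinkReflect_nonneg_of_cylinder ρ hij hd hρ (h.comp_strictMono ρ hφ)
        (hM.comp hφ.tendsto_atTop) hφeven hFT hFc hC hFS

/-- **Site RP along the OTHER in-plane axis `j`** of a limit point along (frequently) odd boxes:
conjugate the axis-`i` statement by the swap `(i j)`, a symmetry of `μ`. -/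
theorem siteRP_axis'_of_isTiltedBoxLimitAlong (hij : i ≠ j) (hd : ∀ k : Fin d, k = i ∨ k = j)
    (hρ : Continuous ρ) {β : ℝ} {M Q : ℕ → ℕ} {μ : Measure (LGConfig d G)}
    (h : IsTiltedBoxLimitAlong d i j ρ β M Q μ) (hM : Tendsto M atTop atTop)
    (hQ : Tendsto Q atTop atTop) (hodd : ∃ᶠ k in atTop, Odd (M k + 2)) :
    IsReflectionPositiveFor (configSiteReflect (G := G) j) (siteHalfEdges j) μ :=
  IsReflectionPositiveFor.of_conj
    (measurePreserving_configPerm_swap_of_mem_tiltedBoxLimitPoints ρ hij hρ ⟨M, Q, hM, hQ, h⟩)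
    (measurable_configSiteReflect i) (configPerm_swap_configPerm_swap' i j)
    (configSiteReflect_eq_conj_swap i j) (dependsOn_comp_configPerm_swap_siteHalf i j)
    (siteRP_axis_of_isTiltedBoxLimitAlong ρ hij hd hρ h hM hQ hodd)

/-- **Link RP along the other in-plane axis `j`** of a limit point along (frequently) even boxes. -/
theorem linkRP_axis'_of_isTiltedBoxLimitAlong (hij : i ≠ j) (hd : ∀ k : Fin d, k = i ∨ k = j)
    (hρ : Continuous ρ) {β : ℝ} {M Q : ℕ → ℕ} {μ : Measure (LGConfig d G)}
    (h : IsTiltedBoxLimitAlong d i j ρ β M Q μ) (hM : Tendsto M atTop atTop)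
    (hQ : Tendsto Q atTop atTop) (heven : ∃ᶠ k in atTop, Even (M k + 2)) :
    IsReflectionPositiveFor (configLinkReflect (G := G) j) (linkHalfEdges j) μ :=
  IsReflectionPositiveFor.of_conj
    (measurePreserving_configPerm_swap_of_mem_tiltedBoxLimitPoints ρ hij hρ ⟨M, Q, hM, hQ, h⟩)
    (measurable_configLinkReflect i) (configPerm_swap_configPerm_swap' i j)
    (configLinkReflect_eq_conj_swap i j) (dependsOn_comp_configPerm_swap_linkHalf i j)
    (linkRP_axis_of_isTiltedBoxLimitAlong ρ hij hd hρ h hM hQ heven)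

/-- **Every two-dimensional tilted limit point is site-RP along both in-plane axes or link-RP along
both in-plane axes** (`i ≠ j` exhausting the axes, compact Hausdorff second countable `G`, continuous
`ρ`, every real `β`): its defining family of square boxes has infinitely many odd sides or infinitely
many even sides. -/
theorem siteRP_or_linkRP_axes_of_mem_tiltedBoxLimitPoints (hij : i ≠ j)
    (hd : ∀ k : Fin d, k = i ∨ k = j) (hρ : Continuous ρ) {β : ℝ} {μ : Measure (LGConfig d G)}
    (hμ : μ ∈ tiltedBoxLimitPoints d i j ρ β) :
    (IsReflectionPositiveFor (configSiteReflect (G := G) i) (siteHalfEdges i) μ ∧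
      IsReflectionPositiveFor (configSiteReflect (G := G) j) (siteHalfEdges j) μ) ∨
    (IsReflectionPositiveFor (configLinkReflect (G := G) i) (linkHalfEdges i) μ ∧
      IsReflectionPositiveFor (configLinkReflect (G := G) j) (linkHalfEdges j) μ) := by
  obtain ⟨M, Q, hM, hQ, h⟩ := hμ
  by_cases hodd : ∃ᶠ k in atTop, Odd (M k + 2)
  · exact Or.inl ⟨siteRP_axis_of_isTiltedBoxLimitAlong ρ hij hd hρ h hM hQ hodd,
      siteRP_axis'_of_isTiltedBoxLimitAlong ρ hij hd hρ h hM hQ hodd⟩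
  · have heven : ∃ᶠ k in atTop, Even (M k + 2) := by
      rw [not_frequently] at hodd
      exact (hodd.mono fun k hk => Nat.not_odd_iff_even.1 hk).frequently
    exact Or.inr ⟨linkRP_axis_of_isTiltedBoxLimitAlong ρ hij hd hρ h hM hQ heven,
      linkRP_axis'_of_isTiltedBoxLimitAlong ρ hij hd hρ h hM hQ heven⟩

/-! ## Both kinds of limit points exist -/

omit [T2Space G] in
/-- Limit points along a prescribed family of square boxes exist: the transported states of the
boxes `ℤ^d/Γ(M₀ k + 2, M₀ k + 2, 2(M₀ k + 2))` have a subsequence converging on all bounded continuous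
functions (compactness and metrisability of the probability measures on the compact metrisable
`G^{edges(ℤ^d)}`), for every `M₀ → ∞`. -/
theorem exists_isTiltedBoxLimitAlong_subseq [T2Space G] (hρ : Continuous ρ) (β : ℝ) (M₀ : ℕ → ℕ) :
    ∃ (μ : Measure (LGConfig d G)) (φ : ℕ → ℕ), StrictMono φ ∧
      IsTiltedBoxLimitAlong d i j ρ β (fun k => M₀ (φ k)) (fun k => M₀ (φ k)) μ := by
  haveI := fun k : ℕ =>
    isProbabilityMeasure_tiltedState (d := d) i j (M₀ k + 2) (M₀ k + 2) (2 * (M₀ k + 2)) ρ hρ β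
  let P : ℕ → ProbabilityMeasure (LGConfig d G) := fun k =>
    ⟨tiltedState i j (M₀ k + 2) (M₀ k + 2) (2 * (M₀ k + 2)) ρ β, inferInstance⟩
  obtain ⟨μ, -, φ, hφ, hlim⟩ :=
    (isCompact_univ (X := ProbabilityMeasure (LGConfig d G))).tendsto_subseq
      fun n => Set.mem_univ (P n)
  refine ⟨(μ : Measure (LGConfig d G)), φ, hφ, inferInstance, fun F S _ hFc hFb => ?_⟩
  obtain ⟨C, hC⟩ := hFb
  let Fb : BoundedContinuousFunction (LGConfig d G) ℝ :=
    BoundedContinuousFunction.ofNormedAddCommGroup F hFc C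
      (fun U => by simpa [Real.norm_eq_abs] using hC U)
  have hE : (fun k : ℕ => ∫ U, F (tiltedLift d i j (M₀ (φ k) + 2) (M₀ (φ k) + 2)
      (2 * (M₀ (φ k) + 2)) U)
      ∂(gibbs ρ (tiltedUnit d i j (M₀ (φ k) + 2) (M₀ (φ k) + 2) (2 * (M₀ (φ k) + 2))) β)) =
      fun k => ∫ U, Fb U ∂(P (φ k) : Measure (LGConfig d G)) :=
    funext fun k => (integral_tiltedState i j (M₀ (φ k) + 2) (M₀ (φ k) + 2) (2 * (M₀ (φ k) + 2)) ρ β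
      hFc.measurable).symm
  have key : Tendsto (fun k : ℕ => ∫ U, Fb U ∂(P (φ k) : Measure (LGConfig d G))) atTop
      (𝓝 (∫ U, Fb U ∂(μ : Measure (LGConfig d G)))) :=
    (ProbabilityMeasure.tendsto_iff_forall_integral_tendsto.1 hlim) Fb
  rw [hE]
  exact key

/-- **Tilted limit points along ODD boxes exist** (every real `β`): a limit along a family whose
sides `M_k + 2` are all odd. -/
theorem exists_isTiltedBoxLimitAlong_odd (hρ : Continuous ρ) (β : ℝ) :
    ∃ (μ : Measure (LGConfig d G)) (M Q : ℕ → ℕ), Tendsto M atTop atTop ∧ Tendsto Q atTop atTop ∧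
      IsTiltedBoxLimitAlong d i j ρ β M Q μ ∧ ∀ k, Odd (M k + 2) := by
  obtain ⟨μ, φ, hφ, h⟩ :=
    exists_isTiltedBoxLimitAlong_subseq (d := d) (i := i) (j := j) ρ hρ β (fun k => 2 * k + 1)
  have hT : Tendsto (fun k : ℕ => 2 * φ k + 1) atTop atTop :=
    tendsto_atTop_mono (fun k => by omega) hφ.tendsto_atTop
  exact ⟨μ, fun k => 2 * φ k + 1, fun k => 2 * φ k + 1, hT, hT, h, fun k => ⟨φ k + 1, by ring⟩⟩

/-- **Tilted limit points along EVEN boxes exist** (every real `β`): a limit along a family whose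
sides `M_k + 2` are all even. -/
theorem exists_isTiltedBoxLimitAlong_even (hρ : Continuous ρ) (β : ℝ) :
    ∃ (μ : Measure (LGConfig d G)) (M Q : ℕ → ℕ), Tendsto M atTop atTop ∧ Tendsto Q atTop atTop ∧
      IsTiltedBoxLimitAlong d i j ρ β M Q μ ∧ ∀ k, Even (M k + 2) := by
  obtain ⟨μ, φ, hφ, h⟩ :=
    exists_isTiltedBoxLimitAlong_subseq (d := d) (i := i) (j := j) ρ hρ β (fun k => 2 * k)
  have hT : Tendsto (fun k : ℕ => 2 * φ k) atTop atTop :=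
    tendsto_atTop_mono (fun k => by omega) hφ.tendsto_atTop
  exact ⟨μ, fun k => 2 * φ k, fun k => 2 * φ k, hT, hT, h, fun k => ⟨φ k + 1, by ring⟩⟩

/-- **In two dimensions there is, at every real `β`, a tilted limit point which is site-reflection
positive along both axes**, and one which is link-reflection positive along both axes. -/
theorem exists_mem_tiltedBoxLimitPoints_siteRP_axes (hij : i ≠ j) (hd : ∀ k : Fin d, k = i ∨ k = j)
    (hρ : Continuous ρ) (β : ℝ) :
    (∃ μ ∈ tiltedBoxLimitPoints d i j ρ β,
      IsReflectionPositiveFor (configSiteReflect (G := G) i) (siteHalfEdges i) μ ∧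
      IsReflectionPositiveFor (configSiteReflect (G := G) j) (siteHalfEdges j) μ) ∧
    (∃ μ ∈ tiltedBoxLimitPoints d i j ρ β,
      IsReflectionPositiveFor (configLinkReflect (G := G) i) (linkHalfEdges i) μ ∧
      IsReflectionPositiveFor (configLinkReflect (G := G) j) (linkHalfEdges j) μ) := by
  constructor
  · obtain ⟨μ, M, Q, hM, hQ, h, hodd⟩ := exists_isTiltedBoxLimitAlong_odd (d := d) (i := i) (j := j) ρ hρ β
    exact ⟨μ, ⟨M, Q, hM, hQ, h⟩,
      siteRP_axis_of_isTiltedBoxLimitAlong ρ hij hd hρ h hM hQ (Frequently.of_forall hodd),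
      siteRP_axis'_of_isTiltedBoxLimitAlong ρ hij hd hρ h hM hQ (Frequently.of_forall hodd)⟩
  · obtain ⟨μ, M, Q, hM, hQ, h, heven⟩ := exists_isTiltedBoxLimitAlong_even (d := d) (i := i) (j := j) ρ hρ β
    exact ⟨μ, ⟨M, Q, hM, hQ, h⟩,
      linkRP_axis_of_isTiltedBoxLimitAlong ρ hij hd hρ h hM hQ (Frequently.of_forall heven),
      linkRP_axis'_of_isTiltedBoxLimitAlong ρ hij hd hρ h hM hQ (Frequently.of_forall heven)⟩

end TiltedRP

end Summit.QuantumFields.GaugeBoot
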